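import Literature.AlgebraicGeometry.Limits.LocalizationProdLimit
import Literature.AlgebraicGeometry.Motives.SmoothSpread
import HarnessLib

/-!
# Limits of schemes: smooth over `Spec A_S` ⇒ smooth over some `D(s)`

Topic: `Literature/AlgebraicGeometry/Limits`; fourth file on the localization diagram
(`Limits/LocalizationDiagram`: `Spec A_S = lim_{s ∈ S} Spec A[1/s]`; `Limits/LocalizationProdLimit`:
`P ×_A Spec A_S = lim_s P ×_A Spec A[1/s]`, Stacks 01ZC; `Limits/LocalizationIsoSpread`: isomorphisms
spread out, EGA IV₃ 8.8.2.5). Main result (`LocApprox.exists_forall_smooth_snd`): let `P → Spec A`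
be quasi-compact and locally of finite presentation, `S ⊆ A` a submonoid and `A_S` its
localization. If the base change `P ×_A Spec A_S → Spec A_S` is smooth, then there is `s ∈ S` such
that `P ×_A Spec T → Spec T` is smooth for every multiple `t` of `s` and every model `T` of
`A[1/t]` — **smoothness descends through the limit `Spec A_S = lim Spec A[1/s]`** (The Stacks
project, Tag 0C0C: "if `X → Y` [of finite presentation, `Y = lim Y_i`] is smooth, then
`X_i → Y_i` is smooth for some `i`", here for the cofiltered system of basic open neighbourhoods;
EGA IV₄ 17.7.8 (ii)). With `S = A ∖ 𝔭`: a scheme of finite presentation over `A` which is smooth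
over the local ring `A_𝔭` is smooth over an open neighbourhood `D(s)` of `𝔭`; with `A` a domain
and `A_S` its fraction field: smooth generic fibre ⇒ smooth over a dense open subset. Consumer in
this tree: the local-to-global construction of Néron models
(`Literature.NumberTheory.EllipticCurves.NeronModel*`: a model over an open neighbourhood of `𝔭` of
the local Néron model at `𝔭` is smooth after shrinking the neighbourhood).

## Proof

Pointwise, smoothness is formal smoothness of the stalk map (Mathlib `Scheme.Hom.smoothLocus`,
an open subset for morphisms locally of finite presentation, equal to `⊤` iff the morphism is
smooth). Since `Spec A_S → Spec A` is flat and surjective on stalks, every point of `P` in the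
image of `P ×_A Spec A_S` lies in the smooth locus `W` of `P → Spec A`
(`Literature.AlgebraicGeometry.Motives.mem_smoothLocus_of_isPullback`), i.e. the preimage of `W` in
the limit `P ×_A Spec A_S = lim_s P ×_A Spec A[1/s]` is everything; by quasi-compactness
(Mathlib `exists_map_eq_top`) the preimage of `W` in some stage `P ×_A Spec A[1/s]` is already
everything (`exists_range_fst_subset_smoothLocus`). Finally, for an `A`-algebra `T` with
`Spec T → Spec A` an open immersion, `P ×_A Spec T → Spec T` is smooth iff the open immersion
`P ×_A Spec T → P` lands in `W` (`smooth_snd_iff_range_fst_subset_smoothLocus`), and the image of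
`P ×_A Spec T → P` is the preimage of `D(t) ⊆ D(s)` for a model `T` of `A[1/t]`, `s ∣ t`.

## References

* The Stacks project, Tag 0C0C (smoothness descends through limits of schemes), Tag 01ZM.
  [StacksProject]
* A. Grothendieck, EGA IV₄, Prop. 17.7.8 (ii) (Publ. Math. IHÉS 32, 1967). [EGAIV4]
* A. Grothendieck, EGA IV₃, §8 and Thm. 8.10.5 (Publ. Math. IHÉS 28, 1966). [EGAIV3]
-/

noncomputable section

universe u

open CategoryTheory CategoryTheory.Limits AlgebraicGeometry TopologicalSpace MonoidalCategory
open Opposite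

namespace Literature.AlgebraicGeometry.Limits

namespace LocApprox

open Literature.AlgebraicGeometry.Motives (SchemeOver specOver mem_smoothLocus_of_isPullback)

set_option backward.isDefEq.respectTransparency false

/-! ## Smoothness of a base change along an open immersion, read off on the smooth locus -/

section OpenBase

variable {A : Type u} [CommRing A] (P : SchemeOver A) (T : Type u) [CommRing T] [Algebra A T]

/-- An open of the source is everything iff it contains the range: `f ⁻¹ᵁ U = ⊤ ↔ range f ⊆ U`.
[folklore] -/
theorem preimage_eq_top_iff_range_subset {X Y : Scheme.{u}} (f : X ⟶ Y) (U : Y.Opens) :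
    f ⁻¹ᵁ U = ⊤ ↔ Set.range f ⊆ (U : Set Y) := by
  constructor
  · rintro h _ ⟨x, rfl⟩
    have hx : x ∈ f ⁻¹ᵁ U := by rw [h]; trivial
    exact hx
  · intro h
    ext x
    exact ⟨fun _ => trivial, fun _ => h ⟨x, rfl⟩⟩

/-- **Smoothness over an open subscheme of the base, read off on the smooth locus.** Let
`P → Spec A` be locally of finite presentation and `T` an `A`-algebra with `Spec T → Spec A` an open
immersion (e.g. `T = A[1/t]`). Then the base change `P ×_A Spec T → Spec T` is smooth iff the open
immersion `P ×_A Spec T → P` lands in the smooth locus of `P → Spec A` (Mathlib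
`Scheme.Hom.smoothLocus`: the open set of points at which the stalk map is formally smooth;
`P ×_A Spec T → Spec T → Spec A` equals `P ×_A Spec T → P → Spec A`, smoothness of a composite with
an open immersion on either side). [folklore] -/
theorem smooth_snd_iff_range_fst_subset_smoothLocus [LocallyOfFinitePresentation P.hom]
    [IsOpenImmersion (Spec.map (CommRingCat.ofHom (algebraMap A T)))] :
    Smooth (pullback.snd P.hom (Spec.map (CommRingCat.ofHom (algebraMap A T)))) ↔
      Set.range (pullback.fst P.hom (Spec.map (CommRingCat.ofHom (algebraMap A T)))) ⊆
        (P.hom.smoothLocus : Set P.left) := by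
  set i := Spec.map (CommRingCat.ofHom (algebraMap A T))
  rw [← preimage_eq_top_iff_range_subset, Scheme.Hom.preimage_smoothLocus_eq,
    Scheme.Hom.smoothLocus_eq_top_iff, pullback.condition]
  constructor
  · intro h
    infer_instance
  · intro h
    exact MorphismProperty.of_postcomp (W := @Smooth) (W' := @IsOpenImmersion)
      (pullback.snd P.hom i) i inferInstance h

/-- The range of `P ×_A Spec T → P` is the preimage of the range of `Spec T → Spec A`; for a model
`T` of `A[1/t]` this is the preimage of the basic open set `D(t)`. [folklore] -/
theorem range_fst_eq_preimage_basicOpen (t : A) [IsLocalization.Away t T] :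
    Set.range (pullback.fst P.hom (Spec.map (CommRingCat.ofHom (algebraMap A T)))) =
      P.hom ⁻¹' (PrimeSpectrum.basicOpen t : Set (PrimeSpectrum A)) := by
  rw [Scheme.Pullback.range_fst]
  exact congrArg _ (PrimeSpectrum.localization_away_comap_range T t)

end OpenBase

/-! ## The smooth locus contains the image of `P ×_A Spec A_S`, hence of some stage -/

section Limit

variable {A : Type u} [CommRing A] (S : Submonoid A) (B : Type u) [CommRing B] [Algebra A B]

/-- `Spec A_S → Spec A` is flat. [folklore] -/
theorem flat_specMap_algebraMap [IsLocalization S B] :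
    Flat (Spec.map (CommRingCat.ofHom (algebraMap A B))) := by
  rw [HasRingHomProperty.Spec_iff (P := @Flat)]
  change (algebraMap A B).Flat
  rw [RingHom.flat_algebraMap_iff]
  exact IsLocalization.flat B S

/-- `Spec A_S → Spec A` is surjective on stalks. [folklore] -/
theorem surjectiveOnStalks_specMap_algebraMap [IsLocalization S B] :
    SurjectiveOnStalks (Spec.map (CommRingCat.ofHom (algebraMap A B))) :=
  SurjectiveOnStalks.Spec_iff.mpr (RingHom.surjectiveOnStalks_of_isLocalization (M := S) B)

variable [IsLocalization S B] (P : SchemeOver A)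

include S in
/-- **If `P ×_A Spec A_S → Spec A_S` is smooth, the smooth locus of `P → Spec A` contains the image
of `P ×_A Spec A_S`** (`P` locally of finite presentation over `A`): `Spec A_S → Spec A` is flat and
surjective on stalks, so the stalk maps of `P → Spec A` at points of the image are isomorphic to
stalk maps of the base change (`Literature.AlgebraicGeometry.Motives.mem_smoothLocus_of_isPullback`). [folklore] -/
theorem range_fst_subset_smoothLocus_of_smooth [LocallyOfFinitePresentation P.hom]
    (h : Smooth (pullback.snd P.hom (Spec.map (CommRingCat.ofHom (algebraMap A B))))) :
    Set.range (pullback.fst P.hom (Spec.map (CommRingCat.ofHom (algebraMap A B)))) ⊆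
      (P.hom.smoothLocus : Set P.left) := by
  set i := Spec.map (CommRingCat.ofHom (algebraMap A B))
  haveI : Flat i := flat_specMap_algebraMap S B
  haveI : SurjectiveOnStalks i := surjectiveOnStalks_specMap_algebraMap S B
  rintro _ ⟨x, rfl⟩
  refine mem_smoothLocus_of_isPullback (IsPullback.of_hasPullback P.hom i) ?_
  rw [Scheme.Hom.smoothLocus_eq_top]
  trivial

/-- **Smoothness descends through `Spec A_S = lim Spec A[1/s]`, stage form.** Let `P → Spec A` be
quasi-compact and locally of finite presentation with `P ×_A Spec A_S → Spec A_S` smooth. Then for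
some `s ∈ S` the open subscheme `P ×_A Spec A[1/s]` of `P` lies in the smooth locus of `P → Spec A`:
the preimage of the smooth locus in the limit `P ×_A Spec A_S = lim_s P ×_A Spec A[1/s]` of
quasi-compact schemes is everything, hence so is its preimage in some stage (Mathlib
`exists_map_eq_top`). (Stacks, Tag 0C0C, for the system of basic open neighbourhoods.)
[cite: StacksProject, Tag 0C0C] -/
theorem exists_range_fst_subset_smoothLocus [QuasiCompact P.hom] [LocallyOfFinitePresentation P.hom]
    (h : Smooth (pullback.snd P.hom (Spec.map (CommRingCat.ofHom (algebraMap A B))))) :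
    ∃ s : Idx S, Set.range (pullback.fst P.hom
        (Spec.map (CommRingCat.ofHom (algebraMap A (loc S s))))) ⊆ (P.hom.smoothLocus : Set P.left) := by
  -- the open `W|` of the stage `1`, whose preimage in the limit is everything
  let U : ((prodDiagram S P).obj default).Opens :=
    (pullback.fst P.hom (Spec.map (CommRingCat.ofHom (algebraMap A (loc S default))))) ⁻¹ᵁ
      P.hom.smoothLocus
  have hU : (prodCone S B P).π.app default ⁻¹ᵁ U = ⊤ := by
    change ((prodCone S B P).π.app default ≫ pullback.fst _ _) ⁻¹ᵁ P.hom.smoothLocus = ⊤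
    rw [prodCone_π_app_fst, preimage_eq_top_iff_range_subset]
    exact range_fst_subset_smoothLocus_of_smooth S B P h
  obtain ⟨t, fts, ht⟩ :=
    exists_map_eq_top (prodDiagram S P) (prodCone S B P) (isLimitProdCone S B P) U hU
  refine ⟨t, ?_⟩
  rw [← preimage_eq_top_iff_range_subset]
  change (pullback.fst P.hom ((baseDiagram S).obj t).hom) ⁻¹ᵁ P.hom.smoothLocus = ⊤
  rw [← prodDiagram_map_fst S P fts]
  exact ht

/-- **Smoothness descends through `Spec A_S = lim Spec A[1/s]`** (The Stacks project, Tag 0C0C;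
EGA IV₄ 17.7.8 (ii), for the cofiltered system of basic open neighbourhoods `D(s)`, `s ∈ S`). Let
`P → Spec A` be quasi-compact and locally of finite presentation, and suppose the base change
`P ×_A Spec A_S → Spec A_S` to the localization `A_S` is smooth. Then there is `s ∈ S` such that for
every multiple `t` of `s` (i.e. `D(t) ⊆ D(s)`) and every model `T` of `A[1/t]`
(`IsLocalization.Away t T`), the base change `P ×_A Spec T → Spec T` is smooth. (With
`S = A ∖ 𝔭`, `A_S = A_𝔭`, `IsLocalization.AtPrime`: smooth over the local ring `A_𝔭` ⇒ smooth over
every small enough basic open neighbourhood `D(t) ∋ 𝔭`; with `A` a domain and `A_S = Frac A`: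
smooth generic fibre ⇒ smooth over a dense open subset.)
[cite: StacksProject, Tag 0C0C] -/
theorem exists_forall_smooth_snd [QuasiCompact P.hom] [LocallyOfFinitePresentation P.hom]
    (h : Smooth (pullback.snd P.hom (Spec.map (CommRingCat.ofHom (algebraMap A B))))) :
    ∃ s ∈ S, ∀ t : A, s ∣ t → ∀ (T : Type u) [CommRing T] [Algebra A T] [IsLocalization.Away t T],
      Smooth (pullback.snd P.hom (Spec.map (CommRingCat.ofHom (algebraMap A T)))) := by
  obtain ⟨s, hs⟩ := exists_range_fst_subset_smoothLocus S B P h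
  refine ⟨s.val, s.mem, fun t hst T _ _ _ => ?_⟩
  haveI : IsOpenImmersion (Spec.map (CommRingCat.ofHom (algebraMap A T))) :=
    IsOpenImmersion.of_isLocalization t
  have hle : (PrimeSpectrum.basicOpen t : Set (PrimeSpectrum A)) ⊆ PrimeSpectrum.basicOpen s.val := by
    obtain ⟨c, rfl⟩ := hst
    exact PrimeSpectrum.basicOpen_mul_le_left s.val c
  rw [smooth_snd_iff_range_fst_subset_smoothLocus, range_fst_eq_preimage_basicOpen P T t]
  refine subset_trans (Set.preimage_mono hle) ?_
  rw [← range_fst_eq_preimage_basicOpen P (loc S s) s.val]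
  exact hs

end Limit

end LocApprox

end Literature.AlgebraicGeometry.Limits

end
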